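import Summits.QuantumAdvantage.QuantumAdvantage.Theorems.LinnikCubicClassGroupsDegreeOnePrimesEscapeChebotarevDivision
import Summits.QuantumAdvantage.QuantumAdvantage.Theorems.LinnikCubicClassGroupsDegreeOnePrimesEscapeNonsplitPrimeAnyField
import HarnessLib

/-!
# Least primes with a prescribed splitting type: every splitting type occurs below `|d_K|^{L(n)}`

Topic `Summits/QuantumAdvantage/QuantumAdvantage/Theorems`, cell B2b-1 (linnik-cubic), PART A (gen 9);
helper toward the crux `DegreeOnePrimesEscape` (stmt-QuantumAdvantage-11543) of route
`LinnikCubicClassGroups`.  HONEST FRAMING: the value of this file is a THEOREM (kernel-checked, GRH-free,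
Siegel-free, no hypothesis) — NOT summit progress.

The splitting type of an unramified prime `p` in a subfield `E = N^H` of a Galois number field `N` depends
only on the DIVISION of its Frobenius `φ` (Perlis: `|H|·Σ_{f ∈ T_E(p), f ∣ j} f = #{t : t φ^j t⁻¹ ∈ H}`, and
`⟨φ⟩ = ⟨σ⟩` makes these counts agree with those of `σ`).  Hence the Chebotarev–Linnik theorem for
divisions (`exists_frobenius_generates_le`) gives:

* `exists_prime_splitting_as_le` — for `N` Galois of degree `n > 1` and ANY `σ ∈ Gal(N/ℚ)` there is a
  prime `p ≤ |d_N|^{L(n)}`, `p ∤ d_N`, which has, in EVERY intermediate field `E ⊆ N` simultaneously, the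
  splitting type of `σ`: `|Gal(N/E)| · Σ_{f ∈ T_E(p), f ∣ j} f = #{t : t σ^j t⁻¹ ∈ Gal(N/E)}` for all `j`
  (the residue degrees of `p` in `E` are the orbit lengths of `⟨σ⟩` on `Gal(N/ℚ)/Gal(N/E)`);
* `exists_prime_splittingType_le_of_embedding` — for an arbitrary number field `K` of degree `n > 1`
  embedded in a Galois `N` with `[N:ℚ] ≤ n!` and `|d_N| ≤ |d_K|^{[N:ℚ]}` (its Galois closure,
  `exists_galoisClosure`) and any `σ ∈ Gal(N/ℚ)`: a prime `p ≤ |d_K|^{L(n)}`, `p ∤ d_K`, whose splitting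
  type in `K` is that of `σ`.  I.e. EVERY splitting type that occurs at unramified primes of `K` occurs
  below `|d_K|^{L(n)}` — the least prime with a given splitting type (Lagarias–Montgomery–Odlyzko 1979),
  unconditionally, with an inexplicit degree-dependent exponent.

References: J. C. Lagarias, H. L. Montgomery, A. M. Odlyzko, Invent. Math. 54 (1979), Thm. 1.1
[LagariasMontgomeryOdlyzko1979]; R. Perlis, J. Number Theory 9 (1977) [Perlis1977].
-/

noncomputable section

open scoped NumberField nonZeroDivisors
open Finset Real Ideal NumberField
open Literature.NumberTheory.NumberFields Literature.NumberTheory.LFunctions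
  Literature.NumberTheory.LFunctions.NumberField

namespace Summit.QuantumAdvantage.QuantumAdvantage.Theorems.DegreeOnePrimesEscape

/-! ### Group theory: the permutation characters only see the division -/

section Group

variable {G : Type*} [Group G]

/-- `⟨a⟩ = ⟨b⟩ ⟹ ⟨a^j⟩ = ⟨b^j⟩`. -/
theorem zpowers_pow_eq_of_zpowers_eq {a b : G} (h : Subgroup.zpowers a = Subgroup.zpowers b) (j : ℕ) :
    Subgroup.zpowers (a ^ j) = Subgroup.zpowers (b ^ j) := by
  have key : ∀ {a b : G}, Subgroup.zpowers a = Subgroup.zpowers b →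
      Subgroup.zpowers (a ^ j) ≤ Subgroup.zpowers (b ^ j) := by
    intro a b h
    have ha : a ∈ Subgroup.zpowers b := h ▸ Subgroup.mem_zpowers a
    obtain ⟨k, rfl⟩ := Subgroup.mem_zpowers_iff.mp ha
    have e : (b ^ k) ^ j = (b ^ j) ^ k := by
      rw [← zpow_natCast (b ^ k) j, ← zpow_mul, ← zpow_natCast b j, ← zpow_mul, mul_comm]
    rw [Subgroup.zpowers_le, e]
    exact Subgroup.zpow_mem _ (Subgroup.mem_zpowers _) k
  exact le_antisymm (key h) (key h.symm)

/-- `⟨x⟩ = ⟨y⟩ ⟹ (s x s⁻¹ ∈ H ↔ s y s⁻¹ ∈ H)` for every subgroup `H`. -/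
theorem conj_mem_iff_of_zpowers_eq {x y : G} (h : Subgroup.zpowers x = Subgroup.zpowers y)
    (H : Subgroup G) (s : G) : s * x * s⁻¹ ∈ H ↔ s * y * s⁻¹ ∈ H := by
  have hc : ∀ z : G, s * z * s⁻¹ ∈ H ↔ Subgroup.zpowers z ≤ H.comap (MulAut.conj s).toMonoidHom := by
    intro z
    rw [Subgroup.zpowers_le, Subgroup.mem_comap]
    rfl
  rw [hc, hc, h]

/-- The permutation character of `H` at `σ^j` only depends on the division of `σ`:
if `⟨g φ g⁻¹⟩ = ⟨σ⟩` then `#{t : t φ^j t⁻¹ ∈ H} = #{t : t σ^j t⁻¹ ∈ H}`. -/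
theorem natCard_conj_pow_mem_eq [Finite G] {φ g σ : G}
    (hg : Subgroup.zpowers (g * φ * g⁻¹) = Subgroup.zpowers σ) (H : Subgroup G) (j : ℕ) :
    Nat.card {t : G // t * φ ^ j * t⁻¹ ∈ H} = Nat.card {t : G // t * σ ^ j * t⁻¹ ∈ H} := by
  have hj := zpowers_pow_eq_of_zpowers_eq hg j
  rw [conj_pow] at hj
  refine Nat.card_congr
    { toFun := fun t => ⟨t.1 * g⁻¹, by
        have h1 : t.1 * g⁻¹ * (g * φ ^ j * g⁻¹) * (t.1 * g⁻¹)⁻¹ = t.1 * φ ^ j * t.1⁻¹ := by group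
        have := (conj_mem_iff_of_zpowers_eq hj H (t.1 * g⁻¹)).mp (h1 ▸ t.2)
        exact this⟩
      invFun := fun t => ⟨t.1 * g, by
        have h1 : t.1 * g * φ ^ j * (t.1 * g)⁻¹ = t.1 * (g * φ ^ j * g⁻¹) * t.1⁻¹ := by group
        rw [h1]
        exact (conj_mem_iff_of_zpowers_eq hj H t.1).mpr t.2⟩
      left_inv := fun t => Subtype.ext (by simp)
      right_inv := fun t => Subtype.ext (by simp) }

end Group

/-! ### The theorems -/

/-- **A prime with the splitting type of `σ` in every subfield, below `|d_N|^L`.**  For `n > 1` there is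
`L > 0` such that for every Galois number field `N` of degree `n` and every `σ ∈ Gal(N/ℚ)` there is a
prime `p ≤ |d_N|^L`, `p ∤ d_N`, such that for every intermediate field `E ⊆ N` and every `j`:
`|Gal(N/E)| · Σ_{f ∈ T_E(p), f ∣ j} f = #{t ∈ Gal(N/ℚ) : t σ^j t⁻¹ ∈ Gal(N/E)}` — `p` splits in every
subfield of `N` exactly as the division of `σ` prescribes.  Unconditional.
[cite: LagariasMontgomeryOdlyzko1979, Theorem 1.1] -/
theorem exists_prime_splitting_as_le (n : ℕ) (hn : 1 < n) :
    ∃ L : ℝ, 0 < L ∧ ∀ (N : Type) [Field N] [NumberField N] [IsGalois ℚ N],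
      Module.finrank ℚ N = n → ∀ σ : N ≃ₐ[ℚ] N,
        ∃ p : ℕ, p.Prime ∧ (p : ℝ) ≤ ((NumberField.discr N).natAbs : ℝ) ^ L ∧
          ¬ ((p : ℤ) ∣ NumberField.discr N) ∧
          ∀ (E : IntermediateField ℚ N) (j : ℕ),
            Nat.card E.fixingSubgroup * ((splittingType E p).filter (· ∣ j)).sum =
              Nat.card {t : N ≃ₐ[ℚ] N // t * σ ^ j * t⁻¹ ∈ E.fixingSubgroup} := by
  obtain ⟨L, hL, h⟩ := exists_frobenius_generates_le n hn
  refine ⟨L, hL, fun N _ _ _ hN σ => ?_⟩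
  obtain ⟨p, hp, hpx, hpN, Q, hQmax, hQover, φ, g, hφ, hI, hg⟩ := h N hN σ
  refine ⟨p, hp, hpx, hpN, fun E j => ?_⟩
  rw [card_fixingSubgroup_mul_sum_filter_dvd E hp Q hφ hI j]
  exact natCard_conj_pow_mem_eq hg E.fixingSubgroup j

/-- **Every splitting type occurs below `|d_K|^{L(n)}`.**  For `n > 1` there is `L > 0` such that: for
every number field `K` of degree `n`, every Galois number field `N` with `[N:ℚ] ≤ n!` and
`|d_N| ≤ |d_K|^{[N:ℚ]}` together with an embedding `f : K → N` (e.g. the Galois closure of `K`,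
`exists_galoisClosure`), and every `σ ∈ Gal(N/ℚ)`, there is a prime `p ≤ |d_K|^L`, `p ∤ d_K`, whose
splitting type in `K` is that of `σ`: `|Gal(N/f(K))| · Σ_{f' ∈ T_K(p), f' ∣ j} f' = #{t : t σ^j t⁻¹ ∈ Gal(N/f(K))}`
for all `j`.  Unconditional. [cite: LagariasMontgomeryOdlyzko1979, Theorem 1.1] -/
theorem exists_prime_splittingType_le_of_embedding (n : ℕ) (hn : 1 < n) :
    ∃ L : ℝ, 0 < L ∧ ∀ (K : Type) [Field K] [NumberField K], Module.finrank ℚ K = n →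
      ∀ (N : Type) [Field N] [NumberField N] [IsGalois ℚ N] (f : K →ₐ[ℚ] N),
        Module.finrank ℚ N ≤ n.factorial →
        (NumberField.discr N).natAbs ≤ (NumberField.discr K).natAbs ^ Module.finrank ℚ N →
        ∀ σ : N ≃ₐ[ℚ] N,
          ∃ p : ℕ, p.Prime ∧ (p : ℝ) ≤ ((NumberField.discr K).natAbs : ℝ) ^ L ∧
            ¬ ((p : ℤ) ∣ NumberField.discr K) ∧
            ∀ j : ℕ, Nat.card f.fieldRange.fixingSubgroup * ((splittingType K p).filter (· ∣ j)).sum =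
              Nat.card {t : N ≃ₐ[ℚ] N // t * σ ^ j * t⁻¹ ∈ f.fieldRange.fixingSubgroup} := by
  classical
  -- one exponent for every possible degree `m ≤ n!` of `N`
  have hdeg : ∀ m : ℕ, ∃ L : ℝ, 0 < L ∧ (1 < m → ∀ (N : Type) [Field N] [NumberField N]
      [IsGalois ℚ N], Module.finrank ℚ N = m → ∀ σ : N ≃ₐ[ℚ] N,
        ∃ p : ℕ, p.Prime ∧ (p : ℝ) ≤ ((NumberField.discr N).natAbs : ℝ) ^ L ∧
          ¬ ((p : ℤ) ∣ NumberField.discr N) ∧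
          ∀ (E : IntermediateField ℚ N) (j : ℕ),
            Nat.card E.fixingSubgroup * ((splittingType E p).filter (· ∣ j)).sum =
              Nat.card {t : N ≃ₐ[ℚ] N // t * σ ^ j * t⁻¹ ∈ E.fixingSubgroup}) := by
    intro m
    by_cases hm : 1 < m
    · obtain ⟨L, hL, h⟩ := exists_prime_splitting_as_le m hm
      exact ⟨L, hL, fun _ => h⟩
    · exact ⟨1, one_pos, fun h => absurd h hm⟩
  choose Lf hLf hspl using hdeg
  set L : ℝ := (n.factorial : ℝ) * ∑ m ∈ Finset.range (n.factorial + 1), Lf m with hL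
  have hsum1 : ∀ m ≤ n.factorial, Lf m ≤ ∑ m ∈ Finset.range (n.factorial + 1), Lf m := fun m hm =>
    Finset.single_le_sum (f := Lf) (fun i _ => (hLf i).le)
      (Finset.mem_range.mpr (Nat.lt_succ_of_le hm))
  have hfac1 : (1 : ℝ) ≤ n.factorial := by exact_mod_cast Nat.succ_le_of_lt (Nat.factorial_pos n)
  have hLpos : 0 < L := by
    have : 0 < ∑ m ∈ Finset.range (n.factorial + 1), Lf m :=
      lt_of_lt_of_le (hLf 0) (hsum1 0 (Nat.zero_le _))
    rw [hL]; positivity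
  refine ⟨L, hLpos, fun K _ _ hK N _ _ _ f hNle hdN σ => ?_⟩
  set m := Module.finrank ℚ N with hm
  have hKN : Module.finrank ℚ K ≤ m := by
    rw [f.equivFieldRange.toLinearEquiv.finrank_eq]
    have h2 := Module.finrank_mul_finrank ℚ f.fieldRange N
    have hpos : 0 < Module.finrank f.fieldRange N := Module.finrank_pos
    exact le_of_le_of_eq (Nat.le_mul_of_pos_right _ hpos) h2
  have hm1 : 1 < m := lt_of_lt_of_le (hK ▸ hn) hKN
  obtain ⟨p, hp, hpx, hpN, hall⟩ := hspl m hm1 N rfl σ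
  -- sizes: `|d_N|^{L(m)} ≤ (|d_K|^m)^{L(m)} ≤ |d_K|^L`
  set d : ℝ := ((NumberField.discr K).natAbs : ℝ) with hd
  have hd3 : (3 : ℝ) ≤ d := three_le_natAbs_discr_real K (by rw [hK]; exact hn)
  have hd1 : (1 : ℝ) ≤ d := by linarith
  have hdNR : ((NumberField.discr N).natAbs : ℝ) ≤ d ^ (m : ℝ) := by
    rw [Real.rpow_natCast, hd]; exact_mod_cast hdN
  have hpx' : (p : ℝ) ≤ d ^ L := by
    have h1 : ((NumberField.discr N).natAbs : ℝ) ^ Lf m ≤ (d ^ (m : ℝ)) ^ Lf m :=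
      Real.rpow_le_rpow (Nat.cast_nonneg _) hdNR (hLf m).le
    have h2 : (d ^ (m : ℝ)) ^ Lf m = d ^ ((m : ℝ) * Lf m) := by
      rw [← Real.rpow_mul (by linarith)]
    have h3 : (m : ℝ) * Lf m ≤ L := by
      rw [hL]
      have hmf : (m : ℝ) ≤ n.factorial := by exact_mod_cast hNle
      exact mul_le_mul hmf (hsum1 m hNle) (hLf m).le (by positivity)
    calc (p : ℝ) ≤ ((NumberField.discr N).natAbs : ℝ) ^ Lf m := hpx
      _ ≤ d ^ ((m : ℝ) * Lf m) := h2 ▸ h1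
      _ ≤ d ^ L := Real.rpow_le_rpow_of_exponent_le hd1 h3
  -- `p ∤ d_K`, and the splitting type of `p` in `K` is that of `p` in `f(K)`
  have hdisc' : NumberField.discr f.fieldRange = NumberField.discr K :=
    (NumberField.discr_eq_discr_of_algEquiv K f.equivFieldRange).symm
  have hdvd : ¬ ((p : ℤ) ∣ NumberField.discr K) := fun h =>
    hpN (h.trans (hdisc' ▸ NumberField.discr_dvd_discr f.fieldRange N))
  refine ⟨p, hp, hpx', hdvd, fun j => ?_⟩
  rw [ArithmeticallyEquivalent.of_algEquiv f.equivFieldRange p hp]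
  exact hall f.fieldRange j

end Summit.QuantumAdvantage.QuantumAdvantage.Theorems.DegreeOnePrimesEscape

end
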